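import Summits.BirchSwinnertonDyer.BirchSwinnertonDyer.Theorems.ResidualThetaTransportAtTwoSignedMuVanishingAtTwoPlusAnalyticAtW
import Summits.BirchSwinnertonDyer.BirchSwinnertonDyer.Theorems.ResidualThetaTransportAtTwoSignedMuVanishingAtTwoPlusFlatSymbols
import Literature.NumberTheory.EllipticCurves.PAdicLFunctionIntegralityAtTwoQuarterProofs
import HarnessLib

/-!
# Route `ResidualThetaTransportAtTwo`, crux Kμ⁺ `SignedMuVanishingAtTwoPlus` (stmt-BirchSwinnertonDyer-20689), analytic stub FLAT:
# the LAYER-`0` reading in the kernel — on the habitat `[0]⁺_f = L(f,1)/Ω⁺_f ∈ ⅓ℤ` is `2`-INTEGRAL, `L♭(0) = [0]⁺_f`,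
# the layer-`0` Mazur–Tate coefficient is `2[1/4]⁺_f = −[0]⁺_f`, and FLAT at `(W, f)` holds iff-certified by `3·[0]⁺_f` ODD

Cell `bsd-wall`, width seat `bsd-wall-rtt-p4-w2` (g2); lead rtt-p4 g4's memo `Cruxes/SignedMuVanishingAtTwoPlus/FlatCuspSpan.md` §2
asked for «the parity identity (2) alone as a cheap kernel lemma»: it is the Literature proofs file
`PAdicLFunctionIntegralityAtTwoQuarterProofs` (Hecke `T₂` at the cusps `0` AND `1/2` + Manin at `1/4`:
`2[1/4]⁺ = (a₂² − 2a₂ − 1)[0]⁺`, `(a₂ − 3)(a₂ + 1)[0]⁺ ∈ ℤ`). THIS FILE reads it on the habitat (W globally minimal, good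
supersingular at `2` with `a₂(W) = 0`, `f` the newform of `W`): THEOREMS ONLY; `--supports` the crux; BSD is not proved by this.

* `exists_three_mul_ratPlusSymbol_zero_eq_intCast_of_isNewformOf` — `3·[0]⁺_f ∈ ℤ`;
* `norm_ratPlusSymbol_zero_le_one_of_isNewformOf` — `‖[0]⁺_f‖₂ ≤ 1`: the `Ω⁺_f`-normalised `L`-value of every habitat
  newform is `2`-integral (AU-free, certificate-free);
* `norm_constantCoeff_flat_le_one_of_isPollackPair_two` / `…_eq_norm_three_mul` — for every Pollack pair at `2`,
  `L♭(0) = [0]⁺_f` (lead g0 p567665) hence `‖L♭(0)‖₂ = ‖3[0]⁺_f‖₂ = ‖k‖₂` for the integer `k = 3[0]⁺_f`;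
* `ratPlusSymbol_quarter_eq_of_isNewformOf` — `[1/4]⁺_f = −[0]⁺_f/2` (the layer-`0` Mazur–Tate coefficient `2[1/4]⁺ = −[0]⁺`);
* `not_two_dvd_flat_of_odd_three_mul_ratPlusSymbol_zero` — **the layer-`0` certificate in INTEGER currency**: if the integer
  `3·[0]⁺_f` is ODD then `2 ∤ L♭` for every Pollack pair (`= not_two_dvd_flat_of_norm_ratPlusSymbol_zero_eq_one` with the
  norm hypothesis discharged from parity); with the period unit / Abbes–Ullmo this is «`3·L(W,1)/Ω_W` odd ⇒ FLAT».

References: [MazurTateTeitelbaum1986Invent] §I.4 (4.2), §I.8; [CremonaAlgorithms1997] §2.8; [Pollack2003] Prop. 6.18;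
[Sprung2017] Cor. 4.4.
-/

set_option autoImplicit false
set_option linter.dupNamespace false

noncomputable section

open scoped Classical MatrixGroups ModularForm

open CongruenceSubgroup WeierstrassCurve Literature.NumberTheory.EllipticCurves
  Literature.NumberTheory.EllipticCurves.ModularForms Literature.NumberTheory.EllipticCurves.IwasawaAlgebra
  Literature.NumberTheory.EllipticCurves.Rank1Residual
  Summit.BirchSwinnertonDyer.Rank1Residual.Supersingular Summit.BirchSwinnertonDyer.Rank1Residual.X1

namespace Summit.BirchSwinnertonDyer.BirchSwinnertonDyer.Theorems.SignedMuAtTwo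

variable {N : ℕ} [NeZero N] {f : CuspForm (Gamma0 N) 2}
  {W : WeierstrassCurve ℚ} [W.IsElliptic] [W.IsGloballyMinimal]

/-- **`3·[0]⁺_f ∈ ℤ` on the habitat**: for `W` good supersingular at `2` with `a₂(W) = 0` and `f` its newform,
`3·L(f,1)/Ω⁺_f` is an integer (two Hecke relations at `2` and Manin's trick at `1/4`; the `3` is `#W̃(𝔽₂)`).
[cite: MazurTateTeitelbaum1986Invent, §I.4 (4.2) and §I.8] -/
theorem exists_three_mul_ratPlusSymbol_zero_eq_intCast_of_isNewformOf (hf : IsNewformOf W f)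
    (hgood : W.HasGoodReductionAtPrime 2) (ha : W.frobeniusTrace 2 = 0) :
    ∃ k : ℤ, 3 * ratPlusSymbol f 0 = (k : ℚ) := by
  have hap : cuspCoeff f 2 = 0 := by
    rw [cuspCoeff_eq_frobeniusTrace_of_isNewformOf_holds hf hgood, ha]; simp
  exact exists_three_mul_ratPlusSymbol_zero_eq_intCast hf.1
    (cuspCoeff_im_eq_zero_of_coeffField_eq_bot hf.coeffField_eq_bot) (not_dvd_level_of_isNewformOf hf hgood) hap

/-- **`‖[0]⁺_f‖₂ ≤ 1` on the habitat**: the `Ω⁺_f`-normalised `L`-value `L(f,1)/Ω⁺_f` of the newform of a curve good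
supersingular at `2` with `a₂ = 0` is `2`-integral — with no period fact, no Pollack pair and no certificate.
[cite: MazurTateTeitelbaum1986Invent, §I.4 (4.2) and §I.8] -/
theorem norm_ratPlusSymbol_zero_le_one_of_isNewformOf (hf : IsNewformOf W f)
    (hgood : W.HasGoodReductionAtPrime 2) (ha : W.frobeniusTrace 2 = 0) :
    ‖((ratPlusSymbol f 0 : ℚ) : ℚ_[2])‖ ≤ 1 := by
  have hap : cuspCoeff f 2 = ((0 : ℤ) : ℂ) := by
    rw [cuspCoeff_eq_frobeniusTrace_of_isNewformOf_holds hf hgood, ha]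
  exact norm_ratPlusSymbol_zero_le_one_of_even hf.1 (cuspCoeff_im_eq_zero_of_coeffField_eq_bot hf.coeffField_eq_bot)
    (not_dvd_level_of_isNewformOf hf hgood) hap (by decide)

/-- **`[1/4]⁺_f = −[0]⁺_f / 2` on the habitat** — the layer-`0` Mazur–Tate coefficient at `2`, `2[1/4]⁺_f`, is MINUS the
`L`-value `[0]⁺_f`. [cite: MazurTateTeitelbaum1986Invent, §I.4 (4.2)] -/
theorem ratPlusSymbol_quarter_eq_of_isNewformOf (hf : IsNewformOf W f)
    (hgood : W.HasGoodReductionAtPrime 2) (ha : W.frobeniusTrace 2 = 0) :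
    ratPlusSymbol f (1 / 4) = -(ratPlusSymbol f 0) / 2 := by
  have hap : cuspCoeff f 2 = 0 := by
    rw [cuspCoeff_eq_frobeniusTrace_of_isNewformOf_holds hf hgood, ha]; simp
  exact ratPlusSymbol_quarter_eq_of_cuspCoeff_two_eq_zero hf.1 (not_dvd_level_of_isNewformOf hf hgood) hap

/-- **`‖L♭(0)‖₂ ≤ 1` for every Pollack pair at `2` on the habitat, DIRECTLY from the modular symbol** (`L♭(0) = [0]⁺_f`,
lead g0's `constantCoeff_flat_eq_ratPlusSymbol_zero_of_isPollackPair_two`, and the previous bound) — of course `L♭ ∈ Λ` already,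
the point is the identification of the constant term with the `2`-integral rational `[0]⁺_f ∈ ⅓ℤ`.
[cite: Pollack2003, Prop. 6.18] [cite: Sprung2017, Cor. 4.4] -/
theorem norm_constantCoeff_flat_eq_norm_ratPlusSymbol_zero (hf : IsNewformOf W f)
    (hgood : W.HasGoodReductionAtPrime 2) (ha : W.frobeniusTrace 2 = 0)
    {Lplus Lminus : IwasawaAlgebra 2} (hP : IsPollackPair f 2 Lplus Lminus) :
    ‖((PowerSeries.constantCoeff Lminus : ℤ_[2]) : ℚ_[2])‖ = ‖((ratPlusSymbol f 0 : ℚ) : ℚ_[2])‖ := by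
  rw [constantCoeff_flat_eq_ratPlusSymbol_zero_of_isPollackPair_two hf hgood ha hP]

/-- **The layer-`0` certificate of FLAT in INTEGER currency**: on the habitat, if the INTEGER `3·[0]⁺_f` is odd, then `2 ∤ L♭`
for every Pollack pair `(L♯, L♭)` of `f` at `2` (`‖[0]⁺_f‖₂ = ‖k‖₂ = 1` and `not_two_dvd_flat_of_norm_ratPlusSymbol_zero_eq_one`).
Since `3·[0]⁺_f` is ALWAYS an integer (`exists_three_mul_ratPlusSymbol_zero_eq_intCast_of_isNewformOf`), the layer-`0` test for
FLAT at `(W, f)` is exactly the parity of that integer; with the period unit it reads «`3·L(W,1)/Ω_W` odd». [cite: Sprung2017, Cor. 4.4]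
[cite: MazurTateTeitelbaum1986Invent, §I.4 (4.2) and §I.8] -/
theorem not_two_dvd_flat_of_odd_three_mul_ratPlusSymbol_zero (hf : IsNewformOf W f)
    (hgood : W.HasGoodReductionAtPrime 2) (ha : W.frobeniusTrace 2 = 0)
    {k : ℤ} (hk : 3 * ratPlusSymbol f 0 = (k : ℚ)) (hodd : Odd k)
    {Lplus Lminus : IwasawaAlgebra 2} (hP : IsPollackPair f 2 Lplus Lminus) :
    ¬ PowerSeries.C (2 : ℤ_[2]) ∣ Lminus := by
  refine not_two_dvd_flat_of_norm_ratPlusSymbol_zero_eq_one hf hgood ha hP ?_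
  -- `‖[0]⁺‖₂ = ‖3·[0]⁺‖₂ = ‖k‖₂ = 1`
  have h3 : ‖((3 : ℚ) : ℚ_[2])‖ = 1 := by
    have h := (Padic.norm_int_le_one (p := 2) 3)
    rcases h.lt_or_eq with hlt | heq
    · exfalso
      have h2 : (2 : ℤ) ∣ 3 := by exact_mod_cast (Padic.norm_intCast_lt_one_iff (p := 2)).mp hlt
      omega
    · exact_mod_cast heq
  have hk1 : ‖(k : ℚ_[2])‖ = 1 := by
    rcases (Padic.norm_int_le_one (p := 2) k).lt_or_eq with hlt | heq
    · exfalso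
      have h2 : (2 : ℤ) ∣ k := by exact_mod_cast (Padic.norm_intCast_lt_one_iff (p := 2)).mp hlt
      exact (Int.not_even_iff_odd.mpr hodd) (even_iff_two_dvd.mpr h2)
    · exact heq
  have hmul : ((3 : ℚ) : ℚ_[2]) * ((ratPlusSymbol f 0 : ℚ) : ℚ_[2]) = (k : ℚ_[2]) := by
    have h := congrArg (fun x : ℚ ↦ (x : ℚ_[2])) hk
    push_cast at h ⊢
    exact h
  have hn := congrArg (‖·‖) hmul
  simp only [norm_mul, h3, one_mul, hk1] at hn
  exact hn

/-- **Every Mazur–Tate element `θ_n(f)` at `2` of a habitat newform is `2`-INTEGRAL (`‖θ_n(f)‖_sup ≤ 1`, i.e. `μ ≥ 0`), for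
every `n`, with NO Pollack pair in the statement**: its coefficients are the doubled symbols `2[5^s/2^{n+2}]⁺_f`
(`exists_supNorm_eq_norm_two_mul_ratPlusSymbol`, width seat w3), each `2`-integral by Manin + `‖[0]⁺_f‖₂ ≤ 1`
(`norm_two_mul_ratPlusSymbol_le_one_of_even`). Compare `norm_ratPlusSymbol_le_two`, which needed a Pollack pair.
[cite: MazurTateTeitelbaum1986Invent, §I.4 (4.2), §I.8 and §I.13] [cite: PollackWeston2011MT, §3.1] -/
theorem supNorm_mazurTateElement_two_le_one_of_isNewformOf (hf : IsNewformOf W f)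
    (hgood : W.HasGoodReductionAtPrime 2) (ha : W.frobeniusTrace 2 = 0) (n : ℕ) :
    ((mazurTateElement f 2 n).map (algebraMap ℚ (PadicAlgCl 2))).supNorm ≤ 1 := by
  obtain ⟨s, hs⟩ := exists_supNorm_eq_norm_two_mul_ratPlusSymbol f n
  rw [hs]
  have hap : cuspCoeff f 2 = ((0 : ℤ) : ℂ) := by
    rw [cuspCoeff_eq_frobeniusTrace_of_isNewformOf_holds hf hgood, ha]
  have h2N : ¬ 2 ∣ N := not_dvd_level_of_isNewformOf hf hgood
  refine norm_two_mul_ratPlusSymbol_le_one_of_even hf.1 (cuspCoeff_im_eq_zero_of_coeffField_eq_bot hf.coeffField_eq_bot)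
    h2N hap (by decide) ?_
  have h := coprime_den_div_prime_pow (p := 2) h2N
    (((cyclotomicGenerator 2 : ZMod (2 ^ (n + 2))) ^ s.val).val) (n + 2)
  simpa using h

end Summit.BirchSwinnertonDyer.BirchSwinnertonDyer.Theorems.SignedMuAtTwo

end
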